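import Mathlib
import Summits.AtomisticToContinuum.FouriersLaw.Theses.EmbeddedDrudeMourre
import Summits.AtomisticToContinuum.FouriersLaw.Theorems.EmbeddedDrudeMourreDrudeDissolutionStubExcursionSecondDifferenceTubeComoving
import Summits.AtomisticToContinuum.FouriersLaw.Theorems.EmbeddedDrudeMourreDrudeDissolutionStubExcursionSecondDifferenceCriticalSet
import Summits.AtomisticToContinuum.FouriersLaw.Theorems.EmbeddedDrudeMourreDrudeDissolutionResonanceStructure
import HarnessLib

/-!
# The co-moving tubes of the concrete sheet amplitude are `O(η²)`
# (stub B1b″ of line `kinetic-polymer-gas-on-the-time-axis`, request R1 of the sup-norm engine)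
(crux `EmbeddedDrudeMourre.DrudeDissolution`, item stmt-AtomisticToContinuum-12593; `--supports` file, closes
nothing; lead c13)

WHAT. For the concrete sheet amplitude `A = 8H/Q` of the factorisation `Ω = −A·S₁·S₂` (free function with the
defining hypothesis `hA` of `ResonanceStructure`), on the cell `(−π,π]³` read at `p = (k₁,(k₃,k₂))`:
`μ_cell {sin²((k₃−k₁)/2) + A² < η²} ≤ C·η²` (`cellMeasure_tube_comoving_fst_le`) and
`μ_cell {sin²((k₃−k₂)/2) + A² < η²} ≤ C·η²` (`cellMeasure_tube_comoving_snd_le`) for all `η > 0`.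

HOW. The first is `cellMeasure_tube_comoving_le` (p155961) with its three hypotheses discharged: `A` is
`2π`-periodic in `k₃` (from the formula), `k₃`-Lipschitz (uniform bound on `∂A` from `resonance_A_bounds` + mean
value), and on the plane `k₃ = k₁` one has `8·H₀ = A·Q` with `Q ≤ 8(ω₂+4)^{3/2}`. The second follows from the first by
the symmetry `A(k₂,k₃,k₁) = A(k₁,k₃,k₂)` and the invariance of the cell measure under `(k₁,(k₃,k₂)) ↦ (k₂,(k₃,k₁))`
(`measurePreserving_swap`, `Measure.prodAssoc_prod`).
-/

noncomputable section

open MeasureTheory Set Real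
open Literature.MathematicalPhysics.KineticTheory
open Literature.MathematicalPhysics.KineticTheory.PhononBoltzmann

namespace Summit.AtomisticToContinuum.FouriersLaw.Theorems.DrudeDissolution.KineticPolymerGasOnTheTimeAxis

section Concrete

variable {ω₂ : ℝ} (hω : 0 < ω₂) {A : ℝ × ℝ × ℝ → ℝ}
  (hA : ∀ p : ℝ × ℝ × ℝ, A p =
    8 * ((dispersion ω₂ p.1 * dispersion ω₂ p.2.2 +
            dispersion ω₂ p.2.1 * dispersion ω₂ (p.1 + p.2.2 - p.2.1) + 2 * (ω₂ + 2)) *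
          Real.cos ((p.1 + p.2.2) / 2) -
        4 * Real.cos ((p.2.1 - p.1) / 2) * Real.cos ((p.2.2 - p.2.1) / 2)) /
      ((dispersion ω₂ p.1 + dispersion ω₂ p.2.2 + dispersion ω₂ p.2.1 + dispersion ω₂ (p.1 + p.2.2 - p.2.1)) *
        (dispersion ω₂ p.1 * dispersion ω₂ p.2.2 + dispersion ω₂ p.2.1 * dispersion ω₂ (p.1 + p.2.2 - p.2.1))))

include hA in
/-- `A` is `2π`-periodic in the middle slot `k₃`. [folklore] -/
theorem concreteA_periodic_mid (k₁ k₃ k₂ : ℝ) : A (k₁, k₃ + 2 * Real.pi, k₂) = A (k₁, k₃, k₂) := by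
  have hper := dispersion_periodic ω₂
  rw [hA, hA]; simp only
  rw [show k₁ + k₂ - (k₃ + 2 * Real.pi) = (k₁ + k₂ - k₃) - 2 * Real.pi by ring, hper.sub_eq, hper,
    show (k₃ + 2 * Real.pi - k₁) / 2 = (k₃ - k₁) / 2 + Real.pi by ring, Real.cos_add_pi,
    show (k₂ - (k₃ + 2 * Real.pi)) / 2 = (k₂ - k₃) / 2 - Real.pi by ring, Real.cos_sub_pi]
  ring

include hA in
/-- `A` is symmetric under the exchange of the two outer slots `k₁ ↔ k₂`. [folklore] -/
theorem concreteA_swap (p : ℝ × ℝ × ℝ) : A (p.2.2, p.2.1, p.1) = A p := by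
  rw [hA, hA]; simp only
  rw [show p.2.2 + p.1 - p.2.1 = p.1 + p.2.2 - p.2.1 by ring, show (p.2.2 + p.1) / 2 = (p.1 + p.2.2) / 2 by ring,
    show (p.2.1 - p.2.2) / 2 = -((p.2.2 - p.2.1) / 2) by ring, Real.cos_neg,
    show (p.1 - p.2.1) / 2 = -((p.2.1 - p.1) / 2) by ring, Real.cos_neg]
  ring

include hω hA in
/-- `A` is uniformly Lipschitz in the middle slot. [folklore] -/
theorem concreteA_lipschitz_mid : ∃ L : ℝ, 0 ≤ L ∧ ∀ k₁ k₂ x y : ℝ, |A (k₁, x, k₂) - A (k₁, y, k₂)| ≤ L * |x - y| := by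
  obtain ⟨C, hC0, hC⟩ := resonance_A_bounds hω hA ![(1, 0, 0), (0, 1, 0), (0, 0, 1)]
  have hAd : Differentiable ℝ A := (resonance_contDiff_A hω hA 1).differentiable one_ne_zero
  refine ⟨C, hC0, fun k₁ k₂ x y => ?_⟩
  have hder : ∀ t : ℝ, HasDerivAt (fun t : ℝ => A (k₁, t, k₂)) (fderiv ℝ A (k₁, t, k₂) (0, 1, 0)) t := by
    intro t
    have hℓ : HasDerivAt (fun t : ℝ => ((k₁, t, k₂) : ℝ × ℝ × ℝ)) ((0, 1, 0) : ℝ × ℝ × ℝ) t :=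
      (hasDerivAt_const t k₁).prodMk ((hasDerivAt_id t).prodMk (hasDerivAt_const t k₂))
    exact (hAd _).hasFDerivAt.comp_hasDerivAt t hℓ
  have hbd : ∀ t : ℝ, |fderiv ℝ A (k₁, t, k₂) (0, 1, 0)| ≤ C := fun t => by
    have := (hC (k₁, t, k₂)).2.1 1
    simpa using this
  exact abs_sub_le_of_deriv_bound hder hbd x y

include hω hA in
/-- On the first exchange plane, the restricted sheet function is dominated by `A`:
`|H₀(k₁,k₂)| ≤ (ω₂+4)^{3/2}·|A(k₁,k₁,k₂)|`. [folklore] -/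
theorem sheetFn_plane_abs_le_concreteA (k₁ k₂ : ℝ) :
    |2 * (dispersion ω₂ k₁ * dispersion ω₂ k₂ + ω₂ + 2) * Real.cos ((k₁ + k₂) / 2) - 4 * Real.cos ((k₁ - k₂) / 2)| ≤
      Real.sqrt (ω₂ + 4) ^ 3 * |A (k₁, k₁, k₂)| := by
  have hper := dispersion_periodic ω₂
  set M := Real.sqrt (ω₂ + 4) with hM
  have h1 := dispersion_pos hω k₁
  have h2 := dispersion_pos hω k₂
  have hb1 : dispersion ω₂ k₁ ≤ M := dispersion_le_sqrt_add_four ω₂ k₁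
  have hb2 : dispersion ω₂ k₂ ≤ M := dispersion_le_sqrt_add_four ω₂ k₂
  -- `A·Q = 8·H` at `p = (k₁,(k₁,k₂))`, where `H = H₀(k₁,k₂)` and `Q = 4(ω₁+ω₂)ω₁ω₂`
  have hQ : 0 < 4 * (dispersion ω₂ k₁ + dispersion ω₂ k₂) * dispersion ω₂ k₁ * dispersion ω₂ k₂ := by positivity
  have hid : A (k₁, k₁, k₂) * (4 * (dispersion ω₂ k₁ + dispersion ω₂ k₂) * dispersion ω₂ k₁ * dispersion ω₂ k₂) =
      8 * (2 * (dispersion ω₂ k₁ * dispersion ω₂ k₂ + ω₂ + 2) * Real.cos ((k₁ + k₂) / 2) -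
        4 * Real.cos ((k₁ - k₂) / 2)) := by
    rw [hA]; simp only
    rw [show k₁ + k₂ - k₁ = k₂ by ring, show (k₁ - k₁) / 2 = 0 by ring, Real.cos_zero,
      show (k₂ - k₁) / 2 = -((k₁ - k₂) / 2) by ring, Real.cos_neg]
    have hQ' : (dispersion ω₂ k₁ + dispersion ω₂ k₂ + dispersion ω₂ k₁ + dispersion ω₂ k₂) *
        (dispersion ω₂ k₁ * dispersion ω₂ k₂ + dispersion ω₂ k₁ * dispersion ω₂ k₂) ≠ 0 := by positivity
    field_simp
    ring
  have hQle : 4 * (dispersion ω₂ k₁ + dispersion ω₂ k₂) * dispersion ω₂ k₁ * dispersion ω₂ k₂ ≤ 4 * (2 * M ^ 3) := by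
    have : (dispersion ω₂ k₁ + dispersion ω₂ k₂) * dispersion ω₂ k₁ * dispersion ω₂ k₂ ≤ (M + M) * M * M := by
      gcongr
    nlinarith [this]
  have habs : |A (k₁, k₁, k₂)| * (4 * (dispersion ω₂ k₁ + dispersion ω₂ k₂) * dispersion ω₂ k₁ * dispersion ω₂ k₂) =
      8 * |2 * (dispersion ω₂ k₁ * dispersion ω₂ k₂ + ω₂ + 2) * Real.cos ((k₁ + k₂) / 2) - 4 * Real.cos ((k₁ - k₂) / 2)| := by
    have := congrArg abs hid
    rw [abs_mul, abs_of_pos hQ, abs_mul, abs_of_pos (by norm_num : (0 : ℝ) < 8)] at this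
    exact this
  have hA0 := abs_nonneg (A (k₁, k₁, k₂))
  nlinarith [mul_le_mul_of_nonneg_left hQle hA0]

/-- The cell measure is invariant under the exchange of the two outer coordinates
`(k₁,(k₃,k₂)) ↦ (k₂,(k₃,k₁))`. [folklore] -/
theorem measurePreserving_cell_swap_outer :
    MeasurePreserving (fun p : ℝ × ℝ × ℝ => ((p.2.2, p.2.1, p.1) : ℝ × ℝ × ℝ))
      ((volume.restrict (Set.Ioc (-Real.pi) Real.pi)).prod
          ((volume.restrict (Set.Ioc (-Real.pi) Real.pi)).prod (volume.restrict (Set.Ioc (-Real.pi) Real.pi))))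
      ((volume.restrict (Set.Ioc (-Real.pi) Real.pi)).prod
          ((volume.restrict (Set.Ioc (-Real.pi) Real.pi)).prod (volume.restrict (Set.Ioc (-Real.pi) Real.pi)))) := by
  set μ₁ : Measure ℝ := volume.restrict (Set.Ioc (-Real.pi) Real.pi) with hμ₁
  -- `φ = prodAssoc ∘ (swap × id) ∘ swap`
  have h1 : MeasurePreserving (Prod.swap : ℝ × (ℝ × ℝ) → (ℝ × ℝ) × ℝ) (μ₁.prod (μ₁.prod μ₁)) ((μ₁.prod μ₁).prod μ₁) :=
    Measure.measurePreserving_swap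
  have h2 : MeasurePreserving (Prod.map Prod.swap id : (ℝ × ℝ) × ℝ → (ℝ × ℝ) × ℝ) ((μ₁.prod μ₁).prod μ₁)
      ((μ₁.prod μ₁).prod μ₁) :=
    (Measure.measurePreserving_swap).prod (MeasurePreserving.id μ₁)
  have h3 : MeasurePreserving (MeasurableEquiv.prodAssoc : (ℝ × ℝ) × ℝ ≃ᵐ ℝ × ℝ × ℝ) ((μ₁.prod μ₁).prod μ₁)
      (μ₁.prod (μ₁.prod μ₁)) :=
    ⟨MeasurableEquiv.prodAssoc.measurable, Measure.prodAssoc_prod⟩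
  have h := h3.comp (h2.comp h1)
  have hfun : ((MeasurableEquiv.prodAssoc : (ℝ × ℝ) × ℝ ≃ᵐ ℝ × ℝ × ℝ) ∘ (Prod.map Prod.swap id) ∘ Prod.swap) =
      fun p : ℝ × ℝ × ℝ => ((p.2.2, p.2.1, p.1) : ℝ × ℝ × ℝ) := by
    funext p
    simp [MeasurableEquiv.prodAssoc, Equiv.prodAssoc]
  rw [hfun] at h
  exact h

end Concrete

/-- **Registered sub-goal `cellMeasure_tube_comoving_fst_le` (request R1): the co-moving tube of the first exchange
plane is `O(η²)` for the concrete sheet amplitude.** [folklore] -/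
theorem cellMeasure_tube_comoving_fst_le :
    ∀ ω₂ : ℝ, 0 < ω₂ → ∀ A : ℝ × ℝ × ℝ → ℝ,
      (∀ p : ℝ × ℝ × ℝ, A p =
        8 * ((dispersion ω₂ p.1 * dispersion ω₂ p.2.2 +
                dispersion ω₂ p.2.1 * dispersion ω₂ (p.1 + p.2.2 - p.2.1) + 2 * (ω₂ + 2)) *
              Real.cos ((p.1 + p.2.2) / 2) -
            4 * Real.cos ((p.2.1 - p.1) / 2) * Real.cos ((p.2.2 - p.2.1) / 2)) /
          ((dispersion ω₂ p.1 + dispersion ω₂ p.2.2 + dispersion ω₂ p.2.1 + dispersion ω₂ (p.1 + p.2.2 - p.2.1)) *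
            (dispersion ω₂ p.1 * dispersion ω₂ p.2.2 +
              dispersion ω₂ p.2.1 * dispersion ω₂ (p.1 + p.2.2 - p.2.1)))) →
      ∃ C : ℝ, ∀ η : ℝ, 0 < η →
      ((volume.restrict (Set.Ioc (-Real.pi) Real.pi)).prod
          ((volume.restrict (Set.Ioc (-Real.pi) Real.pi)).prod (volume.restrict (Set.Ioc (-Real.pi) Real.pi))))
        {p : ℝ × ℝ × ℝ | Real.sin ((p.2.1 - p.1) / 2) ^ 2 + A p ^ 2 < η ^ 2} ≤ ENNReal.ofReal (C * η ^ 2) := by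
  intro ω₂ hω A hA
  obtain ⟨L, hL0, hL⟩ := concreteA_lipschitz_mid hω hA
  refine cellMeasure_tube_comoving_le ω₂ hω A L (Real.sqrt (ω₂ + 4) ^ 3) hL0 (by positivity) ?_ ?_ ?_
  · intro k₁ k₃ k₂; rw [concreteA_periodic_mid hA]
  · intro k₁ k₂ x y _ _ _ _; exact hL k₁ k₂ x y
  · intro k₁ k₂; exact sheetFn_plane_abs_le_concreteA hω hA k₁ k₂

/-- **Registered sub-goal `cellMeasure_tube_comoving_snd_le` (request R1): the co-moving tube of the second exchange
plane is `O(η²)` for the concrete sheet amplitude.** [folklore] -/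
theorem cellMeasure_tube_comoving_snd_le :
    ∀ ω₂ : ℝ, 0 < ω₂ → ∀ A : ℝ × ℝ × ℝ → ℝ,
      (∀ p : ℝ × ℝ × ℝ, A p =
        8 * ((dispersion ω₂ p.1 * dispersion ω₂ p.2.2 +
                dispersion ω₂ p.2.1 * dispersion ω₂ (p.1 + p.2.2 - p.2.1) + 2 * (ω₂ + 2)) *
              Real.cos ((p.1 + p.2.2) / 2) -
            4 * Real.cos ((p.2.1 - p.1) / 2) * Real.cos ((p.2.2 - p.2.1) / 2)) /
          ((dispersion ω₂ p.1 + dispersion ω₂ p.2.2 + dispersion ω₂ p.2.1 + dispersion ω₂ (p.1 + p.2.2 - p.2.1)) *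
            (dispersion ω₂ p.1 * dispersion ω₂ p.2.2 +
              dispersion ω₂ p.2.1 * dispersion ω₂ (p.1 + p.2.2 - p.2.1)))) →
      ∃ C : ℝ, ∀ η : ℝ, 0 < η →
      ((volume.restrict (Set.Ioc (-Real.pi) Real.pi)).prod
          ((volume.restrict (Set.Ioc (-Real.pi) Real.pi)).prod (volume.restrict (Set.Ioc (-Real.pi) Real.pi))))
        {p : ℝ × ℝ × ℝ | Real.sin ((p.2.1 - p.2.2) / 2) ^ 2 + A p ^ 2 < η ^ 2} ≤ ENNReal.ofReal (C * η ^ 2) := by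
  intro ω₂ hω A hA
  obtain ⟨C, hC⟩ := cellMeasure_tube_comoving_fst_le ω₂ hω A hA
  refine ⟨C, fun η hη => ?_⟩
  have hAc : Continuous A := (resonance_contDiff_A hω hA 0).continuous
  have hset : {p : ℝ × ℝ × ℝ | Real.sin ((p.2.1 - p.2.2) / 2) ^ 2 + A p ^ 2 < η ^ 2} =
      (fun p : ℝ × ℝ × ℝ => ((p.2.2, p.2.1, p.1) : ℝ × ℝ × ℝ)) ⁻¹'
        {p : ℝ × ℝ × ℝ | Real.sin ((p.2.1 - p.1) / 2) ^ 2 + A p ^ 2 < η ^ 2} := by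
    ext p
    simp only [mem_setOf_eq, mem_preimage]
    rw [concreteA_swap hA p]
  have hmeas : MeasurableSet {p : ℝ × ℝ × ℝ | Real.sin ((p.2.1 - p.1) / 2) ^ 2 + A p ^ 2 < η ^ 2} :=
    measurableSet_lt (by fun_prop) measurable_const
  rw [hset, measurePreserving_cell_swap_outer.measure_preimage hmeas.nullMeasurableSet]
  exact hC η hη


end Summit.AtomisticToContinuum.FouriersLaw.Theorems.DrudeDissolution.KineticPolymerGasOnTheTimeAxis

end
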